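import Mathlib

/-!
# PercRepro — connectivity by the cut criterion and clique counting on vertex sets (p3, gen 24)

The combinatorial half of the vertex-deletion proof of the graphic closed form (`TriangleCapGraph`), on a fixed
simple graph `G` and vertex FINSETS `S` (no induced subgraphs, no components):
* `IsConn G S` — THE CUT CRITERION: every nonempty proper subset of `S` sends an edge to its complement in `S`
  (`isConn_singleton`, `isConn_insert`; `isConn_univ_of_connected`: Mathlib's `G.Connected` gives it on `univ`
  through `Walk.exists_boundary_dart`).
* `exists_noncut` — A NON-CUT VERTEX: a connected `S` with `≥ 2` vertices has `v` with `S.erase v` connected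
  (a maximal connected nonempty proper subset `A` and a crossing edge `a — b` give `insert b A = S`).
* `cliques G S k` — the `k`-cliques inside `S`; `card_cliques_succ`: for `v ∈ S` the `(k+1)`-cliques of `S`
  are those of `S.erase v` plus the `k`-cliques of the neighbourhood `nbrs G S v`; `card_cliques_one`,
  `card_cliques_le_choose`.
* `touching G S W` — the edges of `S` meeting `W`; `card_le_card_touching`: in a connected `S` they number at
  least `#W` for every proper `W ⊆ S` (a crossing edge from `W`, induction on `W`); `card_cliques_two_eq`:
  the edges of `S` split into those inside `S ∖ W` and those touching `W`.
Axioms: standard.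
-/

namespace PercRepro

namespace TriangleCap

namespace Graph

open Finset

section Connectivity

variable {V : Type*} (G : SimpleGraph V)

/-- **The cut criterion:** every nonempty proper subset of `S` sends an edge to its complement in `S`. -/
def IsConn (S : Finset V) : Prop :=
  ∀ A, A ⊆ S → A.Nonempty → A ≠ S → ∃ a ∈ A, ∃ b ∈ S, b ∉ A ∧ G.Adj a b

/-- A singleton is connected. -/
theorem isConn_singleton (v : V) : IsConn G {v} := by
  intro A hA hne hne'
  exfalso
  rcases subset_singleton_iff.1 hA with rfl | rfl
  · exact not_nonempty_empty hne
  · exact hne' rfl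

/-- A connected graph satisfies the cut criterion on `univ`. -/
theorem isConn_univ_of_connected [Fintype V] (h : G.Connected) : IsConn G (univ : Finset V) := by
  intro A hA hAne hAu
  obtain ⟨a, ha⟩ := hAne
  obtain ⟨b, hb⟩ : ∃ b, b ∉ A := by
    by_contra hc
    exact hAu (eq_univ_iff_forall.2 (fun x => not_not.1 (not_exists.1 hc x)))
  obtain ⟨p⟩ := h.preconnected a b
  obtain ⟨d, -, hd1, hd2⟩ := p.exists_boundary_dart (A : Set V) (by simpa using ha) (by simpa using hb)
  exact ⟨d.fst, by simpa using hd1, d.snd, mem_univ _, by simpa using hd2, d.adj⟩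

end Connectivity

section ConnectivityDec

variable {V : Type*} [DecidableEq V] (G : SimpleGraph V)

/-- Adding a vertex adjacent to a connected set keeps it connected. -/
theorem isConn_insert {A : Finset V} (hA : IsConn G A) {a b : V} (ha : a ∈ A) (hab : G.Adj a b) :
    IsConn G (insert b A) := by
  by_cases hb : b ∈ A
  · rwa [insert_eq_of_mem hb]
  intro X hX hXne hXA
  by_cases hbX : b ∈ X
  · by_cases hAX : A ⊆ X
    · exact absurd (Subset.antisymm hX (insert_subset hbX hAX)) hXA
    · rw [not_subset] at hAX
      obtain ⟨a', ha'A, ha'X⟩ := hAX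
      have hsub : X.erase b ⊆ A := by
        intro x hx
        rw [mem_erase] at hx
        rcases mem_insert.1 (hX hx.2) with h | h
        · exact absurd h hx.1
        · exact h
      by_cases hXe : (X.erase b).Nonempty
      · have hne : X.erase b ≠ A := by
          intro h
          exact ha'X (mem_of_mem_erase (h ▸ ha'A))
        obtain ⟨a₁, ha₁, b₁, hb₁A, hb₁X, hadj⟩ := hA (X.erase b) hsub hXe hne
        refine ⟨a₁, mem_of_mem_erase ha₁, b₁, mem_insert_of_mem hb₁A, ?_, hadj⟩
        intro hb₁X'
        exact hb₁X (mem_erase.2 ⟨fun h => hb (h ▸ hb₁A), hb₁X'⟩)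
      · rw [not_nonempty_iff_eq_empty] at hXe
        refine ⟨b, hbX, a, mem_insert_of_mem ha, ?_, hab.symm⟩
        intro haX
        have : a ∈ X.erase b := mem_erase.2 ⟨fun h => hb (h ▸ ha), haX⟩
        rw [hXe] at this
        exact notMem_empty a this
  · have hXA' : X ⊆ A := by
      intro x hx
      rcases mem_insert.1 (hX hx) with h | h
      · exact absurd (h ▸ hx) hbX
      · exact h
    by_cases hXeq : X = A
    · subst hXeq
      exact ⟨a, ha, b, mem_insert_self b X, hbX, hab⟩
    · obtain ⟨a₁, ha₁, b₁, hb₁, hb₁X, hadj⟩ := hA X hXA' hXne hXeq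
      exact ⟨a₁, ha₁, b₁, mem_insert_of_mem hb₁, hb₁X, hadj⟩

/-- **A non-cut vertex:** a connected set with at least two vertices has a vertex whose removal keeps it
connected (take a maximal connected nonempty proper subset and a crossing edge). -/
theorem exists_noncut {S : Finset V} (hS : IsConn G S) (h2 : 2 ≤ S.card) :
    ∃ v ∈ S, IsConn G (S.erase v) := by
  classical
  set F := S.powerset.filter (fun A => A.Nonempty ∧ A ≠ S ∧ IsConn G A) with hF
  have hFne : F.Nonempty := by
    obtain ⟨v, hv⟩ := card_pos.1 (by omega : 0 < S.card)
    refine ⟨{v}, ?_⟩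
    rw [hF, mem_filter, mem_powerset]
    refine ⟨singleton_subset_iff.2 hv, singleton_nonempty v, ?_, isConn_singleton G v⟩
    intro h
    have := congrArg Finset.card h
    rw [card_singleton] at this
    omega
  obtain ⟨A, hAF, hmax⟩ := exists_max_image F Finset.card hFne
  rw [hF, mem_filter, mem_powerset] at hAF
  obtain ⟨hAS, hAne, hAS', hAc⟩ := hAF
  obtain ⟨a, ha, b, hbS, hbA, hab⟩ := hS A hAS hAne hAS'
  have hins : IsConn G (insert b A) := isConn_insert G hAc ha hab
  have heq : insert b A = S := by
    by_contra hne
    have hmem : insert b A ∈ F := by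
      rw [hF, mem_filter, mem_powerset]
      exact ⟨insert_subset hbS hAS, insert_nonempty b A, hne, hins⟩
    have := hmax _ hmem
    rw [card_insert_of_notMem hbA] at this
    omega
  refine ⟨b, hbS, ?_⟩
  rw [← heq, erase_insert hbA]
  exact hAc

end ConnectivityDec

section Cliques

variable {V : Type*} [DecidableEq V] (G : SimpleGraph V) [DecidableRel G.Adj]

/-- The `k`-cliques of `G` inside the vertex set `S`. -/
def cliques (S : Finset V) (k : ℕ) : Finset (Finset V) :=
  (S.powersetCard k).filter (fun t => G.IsClique (t : Set V))

/-- The neighbours of `v` inside `S`. -/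
def nbrs (S : Finset V) (v : V) : Finset V := (S.erase v).filter (G.Adj v)

/-- Membership in `cliques`. -/
theorem mem_cliques {S : Finset V} {k : ℕ} {t : Finset V} :
    t ∈ cliques G S k ↔ t ⊆ S ∧ t.card = k ∧ G.IsClique (t : Set V) := by
  simp [cliques, mem_powersetCard, and_assoc]

/-- Membership in `nbrs`. -/
theorem mem_nbrs {S : Finset V} {v w : V} : w ∈ nbrs G S v ↔ w ∈ S ∧ w ≠ v ∧ G.Adj v w := by
  simp only [nbrs, mem_filter, mem_erase]
  tauto

/-- `nbrs G S v ⊆ S.erase v`. -/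
theorem nbrs_subset_erase (S : Finset V) (v : V) : nbrs G S v ⊆ S.erase v := filter_subset _ _

/-- Cliques are bounded by binomial coefficients. -/
theorem card_cliques_le_choose (S : Finset V) (k : ℕ) : (cliques G S k).card ≤ S.card.choose k := by
  calc (cliques G S k).card ≤ (S.powersetCard k).card := card_le_card (filter_subset _ _)
    _ = S.card.choose k := card_powersetCard k S

/-- The `1`-cliques of `S` are its vertices. -/
theorem card_cliques_one (S : Finset V) : (cliques G S 1).card = S.card := by
  have h : cliques G S 1 = S.powersetCard 1 := by
    apply filter_true_of_mem
    intro t ht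
    rw [mem_powersetCard] at ht
    obtain ⟨a, rfl⟩ := card_eq_one.1 ht.2
    rw [coe_singleton]
    exact SimpleGraph.isClique_singleton a
  rw [h, card_powersetCard, Nat.choose_one_right]

/-- The cliques through `v` correspond to the cliques of its neighbourhood one size down: for `v ∈ S`,
`#(cliques S (k+1)) = #(cliques (S.erase v) (k+1)) + #(cliques (nbrs S v) k)`. -/
theorem card_cliques_succ {S : Finset V} {v : V} (hv : v ∈ S) (k : ℕ) :
    (cliques G S (k + 1)).card =
      (cliques G (S.erase v) (k + 1)).card + (cliques G (nbrs G S v) k).card := by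
  rw [← card_filter_add_card_filter_not (fun t => v ∉ t) (s := cliques G S (k + 1))]
  congr 1
  · congr 1
    ext t
    simp only [mem_filter, mem_cliques, subset_erase]
    tauto
  · refine card_bij (fun t _ => t.erase v) ?_ ?_ ?_
    · intro t ht
      simp only [mem_filter, mem_cliques, not_not] at ht
      obtain ⟨⟨htS, htc, htcl⟩, hvt⟩ := ht
      rw [mem_cliques]
      refine ⟨?_, ?_, htcl.subset (coe_subset.2 (erase_subset v t))⟩
      · intro w hw
        rw [mem_erase] at hw
        rw [mem_nbrs]
        exact ⟨htS hw.2, hw.1, htcl (by exact_mod_cast hvt) (by exact_mod_cast hw.2) (Ne.symm hw.1)⟩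
      · rw [card_erase_of_mem hvt, htc]
        rfl
    · intro t₁ ht₁ t₂ ht₂ h
      simp only [mem_filter, not_not] at ht₁ ht₂
      rw [← insert_erase ht₁.2, ← insert_erase ht₂.2, h]
    · intro t' ht'
      rw [mem_cliques] at ht'
      obtain ⟨ht'N, ht'c, ht'cl⟩ := ht'
      have hvt' : v ∉ t' := fun h => notMem_erase v S (nbrs_subset_erase G S v (ht'N h))
      refine ⟨insert v t', ?_, erase_insert hvt'⟩
      simp only [mem_filter, mem_cliques, not_not]
      refine ⟨⟨?_, ?_, ?_⟩, mem_insert_self v t'⟩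
      · exact insert_subset hv (ht'N.trans ((nbrs_subset_erase G S v).trans (erase_subset v S)))
      · rw [card_insert_of_notMem hvt', ht'c]
      · rw [coe_insert]
        refine ht'cl.insert ?_
        intro b hb _
        have := ht'N (by exact_mod_cast hb)
        rw [mem_nbrs] at this
        exact this.2.2

/-- The edges inside `S` touching the vertex set `W`. -/
def touching (S W : Finset V) : Finset (Finset V) :=
  (cliques G S 2).filter (fun t => ∃ w ∈ W, w ∈ t)

/-- In a connected `S`, the edges touching a proper subset `W` number at least `#W`. -/
theorem card_le_card_touching {S : Finset V} (hS : IsConn G S) :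
    ∀ W : Finset V, W ⊆ S → W ≠ S → W.card ≤ (touching G S W).card := by
  intro W
  induction W using Finset.strongInduction with
  | H W ih =>
    intro hW hWS
    rcases W.eq_empty_or_nonempty with rfl | hWne
    · simp
    obtain ⟨a, haW, b, hbS, hbW, hab⟩ := hS W hW hWne hWS
    have hW' : W.erase a ⊆ S := (erase_subset a W).trans hW
    have hW'S : W.erase a ≠ S := by
      intro h
      exact hbW (mem_of_mem_erase (h ▸ hbS))
    have ih' := ih (W.erase a) (erase_ssubset haW) hW' hW'S
    have hab' : a ≠ b := G.ne_of_adj hab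
    have hmem : ({a, b} : Finset V) ∈ touching G S W := by
      rw [touching, mem_filter, mem_cliques]
      refine ⟨⟨?_, card_pair hab', ?_⟩, a, haW, mem_insert_self a {b}⟩
      · exact insert_subset (hW haW) (singleton_subset_iff.2 hbS)
      · rw [coe_pair]
        exact SimpleGraph.isClique_pair.2 (fun _ => hab)
    have hnot : ({a, b} : Finset V) ∉ touching G S (W.erase a) := by
      rw [touching, mem_filter]
      rintro ⟨-, w, hw, hw'⟩
      rw [mem_erase] at hw
      rcases mem_insert.1 hw' with rfl | h
      · exact hw.1 rfl
      · rw [mem_singleton] at h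
        exact hbW (h ▸ hw.2)
    have hsub : insert ({a, b} : Finset V) (touching G S (W.erase a)) ⊆ touching G S W := by
      apply insert_subset hmem
      intro t ht
      rw [touching, mem_filter] at ht ⊢
      obtain ⟨ht1, w, hw, hwt⟩ := ht
      exact ⟨ht1, w, mem_of_mem_erase hw, hwt⟩
    have := card_le_card hsub
    rw [card_insert_of_notMem hnot] at this
    rw [card_erase_of_mem haW] at ih'
    have := hWne.card_pos
    omega

/-- The edges inside `S` split into those inside `S ∖ W` and those touching `W`. -/
theorem card_cliques_two_eq (S W : Finset V) :
    (cliques G S 2).card = (cliques G (S \ W) 2).card + (touching G S W).card := by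
  rw [← card_filter_add_card_filter_not (fun t => ∃ w ∈ W, w ∈ t) (s := cliques G S 2), add_comm]
  congr 1
  congr 1
  ext t
  simp only [mem_filter, mem_cliques, subset_sdiff, disjoint_right, not_exists, not_and]
  tauto

end Cliques

end Graph

end TriangleCap

end PercRepro
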